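import Literature.NumberTheory.Automorphic.Arthur2013.Leaves.TorusConstellations
import HarnessLib

/-!
# Arthur (2013) audit, typed leaves — §45.36 LEMMERMEYER'S PROPOSITION 1 c) (HASSE'S SATZ 25) for `Ġ = T`, GENERAL `μ(Ė)`: norms from `Ė` are totally positive; totally positive units of `Ḟ` squares ⇒ `Q(Ė) = 1` for EVERY CM quadratic `Ė/Ḟ`; then `W_odd = ∅ ⟺ κ_{Ė/Ḟ} ≠ 1`, the square-root ideal is never principal, and for odd `h_Ḟ` (e.g. `Ḟ = ℚ`): `W_odd ≠ ∅` always and the local data off `W_odd` are governed by SQ(V) alone; (v1.1) THE SIGNATURE COUNT (Dirichlet): units of every signature ⇒ totally positive units are squares, so Prop. 1 c) with its LITERAL hypothesis; (v1.2) and conversely, so the two hypotheses are EQUIVALENT for totally real `Ḟ`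

(M112, v1.2 = v1.1 + the converse count, v1.1 = v1 + item (5), every earlier declaration unchanged; a new leaf of the cell's `Leaves/` tree importing M109 `TorusConstellations` — hence M107 `TorusUnits`, M104
`TorusOddPlaces`, M101 `TorusRootsOfUnity`, M99, M97, M92 `TorusWitness`, M86, M78 `TorusDictionary` transitively.  Same
namespace `…Leaves.TECR.TorusDict`, same variable conventions (`c`, `h2 : [Ė:Ḟ] = 2`, `hc : c ≠ 1`, `hTR`, `hTC`;
`[IsCMField Ė]` + `hTR` where Mathlib's CM-field API is used, M107 (D53)).  Every lineage module is left byte-identical.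
0 `def`, 0 `sorry`, no named fact: every hypothesis is a binder.  v1.1 appends section (5): the `𝔽₂`-count closing
v1's residual gap (D64) — Lemmermeyer's hypothesis « units with any given signature » now implies the typed one;
v1.2 appends its converse (Dirichlet's uniqueness), making the two hypotheses equivalent for totally real `Ḟ`.)

SETTING (M107 §45.34, M109 §45.35).  `Ė/Ḟ` quadratic with non-trivial automorphism `c`, `Ḟ` totally real, `Ė` totally
complex (the CM situation of [Ar] d-p.310 for `Ġ = T = U(1)_{Ė/Ḟ}`, `Ż_{∞,u} = μ(Ė)`).  M107 typed Hasse's unit index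
`Q(Ė) = (E_Ė : W_Ė E_Ḟ) ∈ {1, 2}` for general `μ(Ė)` as Mathlib's `IsCMField.indexRealUnits Ė` with Lemmermeyer's
Prop. 1 a) (« $Q(L) = (E_L:W_LE_{L^+}) = (E_L^{\sigma-1}:W_L^2) = (E_L^{\sigma+1} : E_{L^+}^2)$ »: `Q = 1 ⟺` every unit
has `ε / c ε ∈ μ(Ė)²`) and b) (`Q = 2 ⇒ κ = 1`); M109 proved Theorem 1 in full: with `η ∈ μ(Ė) ∖ μ(Ė)²`, `k₁ / c k₁ = η`,
`d = N k₁`, `W_odd = {w : ord_{w∩Ḟ}(d) odd}`:  `W_odd = ∅ ⟺ (d)𝓞_Ḟ` a square `⟺ Q = 2 ∨ κ ≠ 1`, and for `(d)𝓞_Ḟ = J²`: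
`Q = 2 ⟺ J` principal, else `Q = 1`, `κ = ⟨[J]⟩`.  What decides `Q` was thus thrown back onto `Ḟ`-arithmetic EXCEPT for
one input: a criterion for `Q = 1` in terms of `Ḟ` alone.  Lemmermeyer's Prop. 1 c) (Hasse's Satz 25) is that criterion.

 (1) NORMS ARE TOTALLY POSITIVE (`pos_apply_of_algebraMap_eq_mul_apply`, `pos_apply_units_of_algebraMap_eq`,
     `exists_units_algebraMap_eq_mul_apply`; `hTR`, `hTC`).  If `d ∈ Ḟ` has `d = k · c k` in `Ė`, `k ≠ 0`, then `φ(d) > 0`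
     for EVERY real embedding `φ : Ḟ → ℝ` — extend `φ` to `ψ : Ė → ℂ` (Mathlib's `ComplexEmbedding.lift`); `c` is complex
     conjugation in every complex embedding (the tree's `CMQuadraticExtension.apply_conj`), so `φ(d) = |ψ(k)|²`.  And the
     norm `ε · c ε` of a unit of `Ė` is (the image of) a unit of `Ḟ` (`c`-fixed units come from `𝓞_Ḟ`, M92
     `apply_units_eq_self_iff_mem_range`): Lemmermeyer's « Units in $L^+$ that are norms from $L$ are totally positive ».
 (2) PROPOSITION 1 c) (`indexRealUnits_eq_one_of_forall_pos_isSquare`; `[IsCMField Ė]`, `hTR`, general `μ(Ė)`):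
         every totally positive unit of `Ḟ` is a square in `𝓞_Ḟ^×`   ⇒   `Q(Ė) = 1`.
     PROOF (Lemmermeyer's, « hence we get $E_L^{\sigma+1} = E_{L^+}^2$, and our claim follows from a) »): for a unit `ε`
     of `Ė`, `ε · c ε = u = t²` with `t ∈ 𝓞_Ḟ^×` by (1) and the hypothesis; `ξ := ε / t` is an algebraic integer with
     `ξ · c ξ = 1`, so `|ψ(ξ)| = 1` in every complex embedding and `ξ ∈ μ(Ė)` (Kronecker, Mathlib's
     `NumberField.Embeddings.pow_eq_one_of_norm_eq_one`); and `ε / c ε = ε² / (ε · c ε) = ξ²`.  So every unit has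
     `ε^{σ-1} ∈ W_Ė²`, which is `Q = 1` by M107's form of Prop. 1 a) (`indexRealUnits_eq_one_iff_forall_units_sq`).
     The HYPOTHESIS is typed in the form in which Lemmermeyer's proof USES it (« our assumption implies that totally
     positive units are squares »); his literal hypothesis « $L^+$ contains units with any given signature » implies it by
     the `𝔽₂`-count `#(E_Ḟ/E_Ḟ²) = 2^{[Ḟ:ℚ]}` (Dirichlet) — typed in v1.1, item (5) ((D64)).
 (3) CONSEQUENCES WITH THEOREM 1 (CM, general `μ(Ė)`, `Ḟ` whose totally positive units are squares;
     `forall_not_odd_iff_ker_ne_bot_of_forall_pos_isSquare`, `isSquare_spanSingleton_iff_ker_ne_bot_of_forall_pos_isSquare`,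
     `not_isPrincipal_and_ker_eq_zpowers_of_forall_pos_isSquare`, `exists_odd_of_odd_classNumber_of_forall_pos_isSquare`,
     `not_isSquare_spanSingleton_of_odd_classNumber_of_forall_pos_isSquare`,
     `exists_not_two_pow_dvd_of_odd_classNumber_of_forall_pos_isSquare`,
     `exists_isAutomorphic_localData_iff_sq_of_odd_classNumber_of_forall_pos_isSquare`):
         `W_odd = ∅  ⟺  (N k₁)𝓞_Ḟ` an ideal square  ⟺  κ_{Ė/Ḟ} ≠ 1`   (M109 (2) with `Q = 1`);
         `(N k₁)𝓞_Ḟ = J²`  ⇒  `J` is NOT principal and `κ_{Ė/Ḟ} = ⟨[J]⟩`   (only Theorem 1's sub-case 2 (b) occurs);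
         `h_Ḟ` odd  ⇒  `W_odd ≠ ∅` (some `ord_v(N k₁)` odd; `(N k₁)𝓞_Ḟ` never a square; in case (i) every CM quadratic
         `Ė/Ḟ` is essentially ramified; in case (ii) some finite `v` has `2^(m-1) ∤ ord_v(2)`), and for every `c`-fixed
         `V` missing `W_odd`:  exists ⟺ SQ(V)  — the Book's requirement beyond the squares is void off `W_odd` (M109 (7)).
 (4) `Ḟ = ℚ` (`forall_units_rat_eq_sq_of_pos`, `exists_odd_rat`, `not_isSquare_spanSingleton_rat`): `𝓞_ℚ^× = {±1}`
     satisfies the hypothesis of (2) (« units with any given signature »); hence, with `h_ℚ = 1` (Mathlib's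
     `Rat.classNumber_eq`) and M107's `Q = 1` over `ℚ` (`indexRealUnits_eq_one_rat'`): for EVERY imaginary quadratic
     field `Ė = ℚ(k₁)` (`k₁ / σ k₁ = η` generating `μ(Ė)/μ(Ė)²`) some prime `p` has `ord_p(N k₁)` odd — `ℚ(i)`: `η = i`,
     `k₁ = 1 + i`, `N k₁ = 2`; `ℚ(√-3)`: `η = -1`, `k₁ = √-3`, `N k₁ = 3`; `#μ = 2`: `Ė = ℚ(√-α)`, `α` not `□`·unit.
 (5) (v1.1) THE SIGNATURE COUNT (`forall_units_eq_sq_of_pos_of_signatures`; `hTR` only; then Prop. 1 c) with its LITERAL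
     hypothesis, `indexRealUnits_eq_one_of_signatures`, and (3) in that form: `forall_not_odd_iff_ker_ne_bot_of_signatures`,
     `exists_odd_of_odd_classNumber_of_signatures`, `exists_isAutomorphic_localData_iff_sq_of_odd_classNumber_of_signatures`;
     `exists_units_rat_neg_iff`).  “`Ḟ` contains units with any given signature” is typed as
         `∀ S : Set (Ḟ →+* ℝ), ∃ u ∈ 𝓞_Ḟ^×, ∀ φ, φ(u) < 0 ⟺ φ ∈ S`
     and IMPLIES that every totally positive unit is a square in `𝓞_Ḟ^×`.  PROOF (Dirichlet, through Mathlib's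
     `NumberField.Units.exist_unique_eq_mul_prod`, `fundSystem`, `rank Ḟ = #places - 1`): the roots of unity of the totally
     real `Ḟ` are `±1` (a root of unity is `±1` under a real embedding), so every unit is `(-1)^s ∏ fᵢ^{bᵢ}` over the
     fundamental system; changing `(s, b)` by even amounts changes the unit by a square, so its signature — read on the
     `n = r + 1` real places as a vector in `𝔽₂^n` — is a function `Ψ(s̄, b̄)` of the parities `(s̄, b̄) ∈ 𝔽₂ × 𝔽₂^r`; the
     hypothesis makes `Ψ` onto, and a surjection between finite sets of the same size `2^n` is injective; a totally
     positive `u = (-1)^s ∏ fᵢ^{bᵢ}` has `Ψ(s̄, b̄) = 0 = Ψ(0̄, 0̄)`, so `s` and every `bᵢ` are even and `u` is a square.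
     (v1.2) THE CONVERSE — totally positive units squares ⇒ units of every signature — is the same count read
     backwards (`exists_units_neg_iff_of_forall_pos_eq_sq`): if `Ψ(p) = Ψ(q)` then `U(p)·U(q)` is totally positive,
     hence a square `y²`, and the UNIQUENESS in Dirichlet's theorem makes its exponents `pᵢ + qᵢ` the even `2cᵢ` of
     `y²` and its sign `(-1)^{p₀+q₀} = ζ_y² = 1`, so `p = q`; `Ψ` one-to-one ⇒ onto, and every real embedding is
     the embedding of a place.  Hence the EQUIVALENCE of the two hypotheses for totally real `Ḟ`
     (`exists_units_neg_iff_iff_forall_units_eq_sq_of_pos`); the audit needs only H ⇒ H′.  `ℚ` has units of every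
     signature (`±1`, one real embedding).

WHAT THIS DECIDES FOR THE AUDIT (cell GAPS.md, the G-TY-33-7 successor menu (a) “Lemmermeyer Prop. 1 c)”).  For `Ġ = T`
the abelian case of the Book's requirement on `Ż_{∞,u}` restricts beyond the squares for all `V` exactly in the regime
`Q(Ė) = 2 ∨ κ ≠ 1` (M107/M109).  This leaf supplies the criterion ON `Ḟ` ALONE that kills the first alternative for
every CM quadratic `Ė/Ḟ` and every `μ(Ė)` at once — totally positive units of `Ḟ` are squares (Hasse's Satz 25) —, so
that over such `Ḟ` the regime is “some class of `Ḟ` capitulates in `Ė`” (`κ ≠ 1`, generated by the square-root class of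
`(N k₁)`), and over such `Ḟ` of ODD class number (the base `ℚ` first of all) it is EMPTY: `W_odd ≠ ∅` for every `Ė`, and
the requirement beyond SQ(V) is void for local data off `W_odd`.  Since v1.1 the hypothesis is Lemmermeyer's literal one (item (5)).  Not typed: Prop. 1 d)–h) (towers and
composita of CM-fields); the cyclotomic examples (M109 (D61)).

THE TEXT.  [Ar] d-p.310 (as in M86–M109): « We require that the function $\dot f^u_\infty \dot f_u$ on $\dot G(\dot
F^u_\infty) \times G(F)$ be constant on (the diagonal image of) $\dot Z_{\infty,u}$. »  Lemmermeyer1995 §2 (held TeX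
text `paper:arxiv-1202.5777`, chunk 4), Proposition 1 (« Let $K \subset L$ be CM-fields; then »): « a) (Satz 14) $Q(L) =
(E_L:W_LE_{L^+}) = (E_L^{\sigma-1}:W_L^2) = (E_L^{\sigma+1} : E_{L^+}^2)$; », « c) (Satz 25) If $L^+$ contains units
with any given signature, then $Q(L) = 1$. », its proof: « c) Units in $L^+$ that are norms from $L$ are totally
positive; our assumption implies that totally positive units are squares, hence we get $E_L^{\sigma+1} = E_{L^+}^2$, and
our claim follows from a). » (a reference « Satz $*$ » « always refers to Hasse's book [H] »); Theorem 1 (chunk 5) as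
quoted in M109: « 1. If $L/K$ is essentially ramified, then $Q(L) = 1$, and $\kappa_{L/K} = 1$. », « (b) $Q(L) = 1$ and
$\kappa_{L/K} = \langle [\mathfrak a]\rangle$, if $\mathfrak a$ is not principal. », « 1. if $\pi_m\OO_K$ is not an
ideal square, then $Q(L) = 1$ and $\kappa_{L/K} = 1$; », « (b) $Q(L) = 1$, $\kappa_{L/K} = \langle [\mathfrak
b]\rangle$, if $\mathfrak b$ is not principal. ».

DIVERGENCES (cell DIVERGENCE.md §TY-33; (D1)–(D62) of M78–M109 stand).
(D63) TOTALLY POSITIVE; SQUARES.  “`u ∈ Ḟ` totally positive” is typed as `∀ φ : Ḟ →+* ℝ, 0 < φ u` — positivity under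
every REAL embedding (for totally real `Ḟ` these are all the embeddings; Mathlib has no `IsTotallyPositive` predicate in
the pinned version); “`u` is a square” for a unit `u ∈ 𝓞_Ḟ^×` as `∃ t : (𝓞 Ḟ)ˣ, u = t ^ 2` (a square IN THE UNIT GROUP,
which is what « $E_L^{\sigma+1} = E_{L^+}^2$ » says).  Item (1) is proved for every nonzero norm `k · c k`, not only for
norms of units.
(D64) THE HYPOTHESIS OF PROP. 1 c).  Lemmermeyer's hypothesis is « $L^+$ contains units with any given signature » (the
signature map `E_Ḟ → ∏_{φ real} {±1}` is onto); his proof uses it only through « totally positive units are squares »,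
and THAT is the typed hypothesis `hpos`.  For totally real `Ḟ` the two are EQUIVALENT (both say that the signature map
`E_Ḟ/E_Ḟ² → {±1}^{[Ḟ:ℚ]}` between `𝔽₂`-spaces of the same dimension `[Ḟ:ℚ] = r + 1` (Dirichlet: `E_Ḟ ≅ {±1} × ℤ^r`,
`r = [Ḟ:ℚ] - 1`) is bijective), and v1.1's item (5) PROVES H ⇒ H′ over Mathlib's `NumberField.Units.fundSystem` / `exist_unique_eq_mul_prod` (v1 had
left it untyped, so that v1's Prop. 1 c) was the step of Lemmermeyer's proof after its first sentence); with
`indexRealUnits_eq_one_of_signatures` the module's Prop. 1 c) carries his literal hypothesis, for general `μ(Ė)` (his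
Proposition is stated for CM-fields with any `W_L`, as here).  H is typed over the real embeddings `Ḟ →+* ℝ` and sets
`S` of them (« any given signature » = any prescribed set of negative embeddings); inside the proof the signature is read
on the real PLACES (`InfinitePlace Ḟ`, all real, `embedding_of_isReal`), which the embeddings determine.  v1.2 types the
converse H′ ⇒ H as well (`exists_units_neg_iff_of_forall_pos_eq_sq`, by the uniqueness half of Dirichlet's theorem), so
H ⟺ H′ for totally real `Ḟ` (`exists_units_neg_iff_iff_forall_units_eq_sq_of_pos`): v1's typed hypothesis H′ was
neither weaker nor stronger than Lemmermeyer's.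
(D65) SOURCES VERSUS CONTENT.  Lemmermeyer1995 Prop. 1 c) is a PUBLISHED statement (Acta Arith. 72; Hasse 1952 Satz 25
for abelian `L/ℚ`) and is RE-PROVED here over Mathlib for the abstract CM quadratic `Ė/Ḟ` of the cell; nothing of it
enters as a cited fact.  The Arthur manuscript is quoted for the requirement being analysed and is not relied upon.

Sources: Arthur2011Draft [Ar] d-p.309/310 (Lemma 6.2.2, the condition on `Ż_{∞,u}`); Lemmermeyer1995 = F. Lemmermeyer,
*Ideal class groups of cyclotomic number fields I*, Acta Arith. 72 (1995) 347–359, §2 Proposition 1 a), c) and Theorem 1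
(held: `paper:arxiv-1202.5777`); NeukirchANT1999 Ch. I (6.3) (finiteness of the class number, through Mathlib), (10.1)
(place-wise reading, through M104); Mathlib (`IsCMField`, `NumberField.Embeddings.pow_eq_one_of_norm_eq_one`,
`ComplexEmbedding.lift`, `Rat.ringOfIntegersEquiv`, `Rat.classNumber_eq`; v1.1: Dirichlet's unit theorem
`NumberField.Units.exist_unique_eq_mul_prod` / `fundSystem` / `rank`, `NumberField.Units.mem_torsion`).
-/

noncomputable section

open NumberField IsDedekindDomain
open Literature.NumberTheory.GaloisRepresentations
open Literature.NumberTheory.Automorphic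
open scoped nonZeroDivisors ComplexConjugate

namespace Literature.NumberTheory.Automorphic.Arthur2013.Leaves.TECR.TorusDict

variable {F₀ K : Type} [Field F₀] [NumberField F₀] [Field K] [NumberField K] [Algebra F₀ K]
variable (c : K ≃ₐ[F₀] K) (h2 : Module.finrank F₀ K = 2) (hc : c ≠ 1)

section Signatures

open Literature.NumberTheory.GaloisRepresentations.HeckeCharacter
open Literature.NumberTheory.GaloisRepresentations.HeckeCharacter.CMQuadraticExtension

variable (hTR : IsTotallyReal F₀) (hTC : IsTotallyComplex K)

/-! ### (1) Norms from `Ė` are totally positive in `Ḟ` -/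

include h2 hc hTR hTC in
/-- **NORMS FROM A CM QUADRATIC EXTENSION ARE TOTALLY POSITIVE.**  If `d ∈ Ḟ` has `d = k · c k` in `Ė` with `k ≠ 0`,
then `φ(d) > 0` under EVERY real embedding `φ : Ḟ → ℝ`: extend `φ` to `ψ : Ė → ℂ`; since `c` is complex conjugation
in every complex embedding (the tree's `CMQuadraticExtension.apply_conj`), `φ(d) = ψ(k)·\overline{ψ(k)} = |ψ(k)|² > 0`.
Lemmermeyer: « Units in $L^+$ that are norms from $L$ are totally positive ».
[cite: Lemmermeyer1995, §2 Proposition 1 c) proof (« Units in $L^+$ that are norms from $L$ are totally positive »); proved here (for every nonzero norm)] -/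
theorem pos_apply_of_algebraMap_eq_mul_apply {k : K} (hk : k ≠ 0) {d : F₀} (hd : algebraMap F₀ K d = k * c k)
    (φ : F₀ →+* ℝ) : 0 < φ d := by
  haveI : FiniteDimensional F₀ K := Module.finite_of_finrank_eq_succ h2
  set ψ : K →+* ℂ := ComplexEmbedding.lift K (Complex.ofRealHom.comp φ) with hψ
  have h1 : ψ (algebraMap F₀ K d) = ((φ d : ℝ) : ℂ) := by
    rw [hψ, ComplexEmbedding.lift_algebraMap_apply]
    rfl
  have h3 : ((φ d : ℝ) : ℂ) = (Complex.normSq (ψ k) : ℂ) := by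
    rw [← h1, hd, map_mul, apply_conj c h2 hc hTR hTC ψ k, Complex.mul_conj]
  have h4 : φ d = Complex.normSq (ψ k) := by exact_mod_cast h3
  rw [h4]
  exact Complex.normSq_pos.mpr ((map_ne_zero ψ).mpr hk)

include h2 hc hTR hTC in
/-- The norm `N k₁ = k₁ · c k₁ ∈ Ḟ^×` of the element `k₁` of the cell's dictionary (`η = k₁ / c k₁`) is totally
positive. [cite: Lemmermeyer1995, §2 Proposition 1 c) proof (« Units in $L^+$ that are norms from $L$ are totally positive »); proved here] -/
theorem pos_apply_units_of_algebraMap_eq {k₁ : Kˣ} {d : F₀ˣ}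
    (hd : algebraMap F₀ K (d : F₀) = (k₁ : K) * c (k₁ : K)) (φ : F₀ →+* ℝ) : 0 < φ (d : F₀) :=
  pos_apply_of_algebraMap_eq_mul_apply c h2 hc hTR hTC k₁.ne_zero hd φ

include h2 hc in
/-- **THE NORM OF A UNIT OF `Ė` IS A UNIT OF `Ḟ`**: for `ε ∈ 𝓞_Ė^×` there is `u ∈ 𝓞_Ḟ^×` with `u = ε · c ε` in `Ė`
(`ε · c ε` is a unit of `𝓞_Ė` fixed by `c`, and the `c`-fixed units are the units of `Ḟ`, M92
`apply_units_eq_self_iff_mem_range`) — Hasse's / Lemmermeyer's `E_L^{σ+1} ⊆ E_{L^+}`.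
[cite: Lemmermeyer1995, §2 Proposition 1 a) (« $Q(L) = (E_L:W_LE_{L^+}) = (E_L^{\sigma-1}:W_L^2) = (E_L^{\sigma+1} : E_{L^+}^2)$ », the group `E_L^{σ+1} ⊆ E_{L^+}` of norms of units); proved here] -/
theorem exists_units_algebraMap_eq_mul_apply (ε : (𝓞 K)ˣ) :
    ∃ u : (𝓞 F₀)ˣ, algebraMap F₀ K ((u : 𝓞 F₀) : F₀) = algebraMap (𝓞 K) K ε * c (algebraMap (𝓞 K) K ε) := by
  set cε : (𝓞 K)ˣ := Units.map (RingOfIntegers.mapRingHom (c : K →+* K) : 𝓞 K →* 𝓞 K) ε with hcε_def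
  have hcεK : algebraMap (𝓞 K) K (cε : 𝓞 K) = c (algebraMap (𝓞 K) K ε) := rfl
  have hfix : c (algebraMap (𝓞 K) K ((ε * cε : (𝓞 K)ˣ) : 𝓞 K)) = algebraMap (𝓞 K) K ((ε * cε : (𝓞 K)ˣ) : 𝓞 K) := by
    rw [Units.val_mul, map_mul, map_mul, hcεK, CMQuadraticExtension.apply_apply c h2 hc, mul_comm]
  obtain ⟨u, hu⟩ := (apply_units_eq_self_iff_mem_range c h2 hc (ε * cε)).mp hfix
  refine ⟨u, ?_⟩
  have hu' := congrArg (fun x : (𝓞 K)ˣ => algebraMap (𝓞 K) K (x : 𝓞 K)) hu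
  simp only [Units.coe_map, MonoidHom.coe_coe, Units.val_mul, map_mul] at hu'
  rw [hcεK] at hu'
  rw [← hu']
  rfl

/-! ### (2) Lemmermeyer's Proposition 1 c) (Hasse's Satz 25): totally positive units squares ⇒ `Q(Ė) = 1` -/

include h2 hc hTR in
/-- **LEMMERMEYER'S PROPOSITION 1 c) (HASSE'S SATZ 25), GENERAL `μ(Ė)`.**  If every totally positive unit of `Ḟ` is a
square in `𝓞_Ḟ^×` — Lemmermeyer's hypothesis « $L^+$ contains units with any given signature » is used exactly through
this consequence (« our assumption implies that totally positive units are squares ») — then Hasse's unit index of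
EVERY CM quadratic extension `Ė/Ḟ` is `Q(Ė) = 1` (Mathlib's `IsCMField.indexRealUnits Ė = 1`), whatever `μ(Ė)`.
PROOF: for `ε ∈ 𝓞_Ė^×`, `ε · c ε = u ∈ 𝓞_Ḟ^×` (`exists_units_algebraMap_eq_mul_apply`) is totally positive
(`pos_apply_of_algebraMap_eq_mul_apply`), hence `u = t²`; then `ξ = ε / t` has `ξ · c ξ = 1`, so all its conjugates have
absolute value `1` and `ξ ∈ μ(Ė)` (Kronecker, Mathlib's `NumberField.Embeddings.pow_eq_one_of_norm_eq_one`), and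
`ε / c ε = ξ²`: every unit has `ε^{σ-1} ∈ W²`, i.e. `Q = 1` (M107 `indexRealUnits_eq_one_iff_forall_units_sq`,
Prop. 1 a)).
[cite: Lemmermeyer1995, §2 Proposition 1 c) (« (Satz 25) If $L^+$ contains units with any given signature, then $Q(L) = 1$. », proof: « our assumption implies that totally positive units are squares, hence we get $E_L^{\sigma+1} = E_{L^+}^2$, and our claim follows from a). »); proved here (hypothesis in the form "totally positive units are squares")] -/
theorem indexRealUnits_eq_one_of_forall_pos_isSquare [IsCMField K]
    (hpos : ∀ u : (𝓞 F₀)ˣ, (∀ φ : F₀ →+* ℝ, 0 < φ ((u : 𝓞 F₀) : F₀)) → ∃ t : (𝓞 F₀)ˣ, u = t ^ 2) :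
    IsCMField.indexRealUnits K = 1 := by
  have hTC : IsTotallyComplex K := IsCMField.to_isTotallyComplex
  rw [indexRealUnits_eq_one_iff_forall_units_sq c h2 hc hTR]
  intro ε
  have hε0 : algebraMap (𝓞 K) K ε ≠ 0 :=
    (map_ne_zero_iff _ (IsFractionRing.injective (𝓞 K) K)).mpr ε.ne_zero
  obtain ⟨u, hu⟩ := exists_units_algebraMap_eq_mul_apply c h2 hc ε
  obtain ⟨t, rfl⟩ := hpos u (pos_apply_of_algebraMap_eq_mul_apply c h2 hc hTR hTC hε0 hu)
  -- `tK = t` seen in `Ė`: nonzero, `c`-fixed, `ε · c ε = tK²`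
  set tK : K := algebraMap F₀ K (((t : (𝓞 F₀)ˣ) : 𝓞 F₀) : F₀) with htK
  have ht0 : tK ≠ 0 := by
    rw [htK, map_ne_zero_iff _ (algebraMap F₀ K).injective,
      map_ne_zero_iff _ (IsFractionRing.injective (𝓞 F₀) F₀)]
    exact t.ne_zero
  have hct : c tK = tK := c.commutes _
  have hεc : algebraMap (𝓞 K) K ε * c (algebraMap (𝓞 K) K ε) = tK ^ 2 := by
    rw [← hu, htK, Units.val_pow_eq_pow_val, RingOfIntegers.coe_eq_algebraMap (((t : (𝓞 F₀)ˣ) : 𝓞 F₀) ^ 2),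
      map_pow, map_pow]
  have hcε0 : c (algebraMap (𝓞 K) K ε) ≠ 0 := (map_ne_zero c).mpr hε0
  -- `ξ = ε / t`
  set ξ : K := algebraMap (𝓞 K) K ε / tK with hξ
  have hξ0 : ξ ≠ 0 := div_ne_zero hε0 ht0
  have hξc : ξ * c ξ = 1 := by
    rw [hξ, map_div₀, hct, div_mul_div_comm, hεc, ← sq, div_self (pow_ne_zero 2 ht0)]
  -- `ξ` is an algebraic integer (`ε / t`, both units) all of whose conjugates have absolute value `1`
  have hint : IsIntegral ℤ ξ := by
    have : ξ = algebraMap (𝓞 K) K ((ε * (Units.map (algebraMap (𝓞 F₀) (𝓞 K) : 𝓞 F₀ →* 𝓞 K) t)⁻¹ : (𝓞 K)ˣ) : 𝓞 K) := by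
      rw [Units.val_mul, map_mul, map_units_inv, Units.coe_map, MonoidHom.coe_coe, hξ, div_eq_mul_inv]
      rfl
    rw [this]
    exact RingOfIntegers.isIntegral_coe _
  have hnorm : ∀ φ : K →+* ℂ, ‖φ ξ‖ = 1 := fun φ => by
    have h1 : ((‖φ ξ‖ ^ 2 : ℝ) : ℂ) = 1 := by
      rw [← Complex.normSq_eq_norm_sq, ← Complex.mul_conj, ← apply_conj c h2 hc hTR hTC φ ξ, ← map_mul, hξc, map_one]
    have h2' : ‖φ ξ‖ ^ 2 = 1 := by exact_mod_cast h1
    exact (pow_eq_one_iff_of_nonneg (norm_nonneg _) two_ne_zero).1 h2'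
  obtain ⟨n, hn, hξn⟩ := NumberField.Embeddings.pow_eq_one_of_norm_eq_one K ℂ hint hnorm
  refine ⟨Units.mk0 ξ hξ0, isOfFinOrder_iff_pow_eq_one.mpr ⟨n, hn, Units.ext ?_⟩, ?_⟩
  · rw [Units.val_pow_eq_pow_val, Units.val_mk0, hξn, Units.val_one]
  · rw [Units.val_mk0, hξ, div_pow, eq_div_iff (pow_ne_zero 2 ht0), ← hεc]
    field_simp

/-! ### (3) Consequences with Theorem 1 in full (M109): `W_odd = ∅ ⟺ κ ≠ 1`; the square-root ideal is never
principal; odd `h_Ḟ` ⇒ `W_odd ≠ ∅` and the local data off `W_odd` are governed by SQ(V) alone -/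

include h2 hc hTR in
/-- **TOTALLY POSITIVE UNITS SQUARES ⇒ (`W_odd = ∅ ⟺ κ_{Ė/Ḟ} ≠ 1`)** (CM, general `μ(Ė)`): with `Q(Ė) = 1`
(`indexRealUnits_eq_one_of_forall_pos_isSquare`) M109's dichotomy `W_odd = ∅ ⟺ Q = 2 ∨ κ ≠ 1` loses its first
branch — for such `Ḟ`, a CM quadratic `Ė = Ḟ(k₁)` has no odd place for `N k₁` iff some ideal class of `Ḟ`
capitulates in `Ė`.
[cite: Lemmermeyer1995, §2 Proposition 1 c) with Theorem 1 ((i)/(ii) 2 (b): « $Q(L) = 1$ and $\kappa_{L/K} = \langle [\mathfrak a]\rangle$, if $\mathfrak a$ is not principal »), general `μ(Ė)`; proved here] -/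
theorem forall_not_odd_iff_ker_ne_bot_of_forall_pos_isSquare [IsCMField K]
    (hpos : ∀ u : (𝓞 F₀)ˣ, (∀ φ : F₀ →+* ℝ, 0 < φ ((u : 𝓞 F₀) : F₀)) → ∃ t : (𝓞 F₀)ˣ, u = t ^ 2)
    {η : Kˣ} (hη : IsOfFinOrder η) (hns : ¬ ∃ ξ : Kˣ, IsOfFinOrder ξ ∧ η = ξ ^ 2) {k₁ : Kˣ}
    (hk₁ : k₁ * (Units.map (c : K →+* K).toMonoidHom k₁)⁻¹ = η) {d : F₀ˣ}
    (hd : algebraMap F₀ K (d : F₀) = (k₁ : K) * c (k₁ : K)) :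
    (∀ w : HeightOneSpectrum (𝓞 K), ¬ Odd (WithZero.log ((w.under (𝓞 F₀)).valuation F₀ (d : F₀)))) ↔
      (ClassGroup.extendedHom (𝓞 F₀) (𝓞 K)).ker ≠ ⊥ := by
  have hQ : ¬ IsCMField.indexRealUnits K = 2 := by
    rw [indexRealUnits_eq_one_of_forall_pos_isSquare c h2 hc hTR hpos]; decide
  rw [forall_not_odd_iff_indexRealUnits_eq_two_or_ker_ne_bot c h2 hc hTR hη hns hk₁ hd]
  simp only [hQ, false_or]

include h2 hc hTR in
/-- **TOTALLY POSITIVE UNITS SQUARES ⇒ (`(N k₁)𝓞_Ḟ` an ideal square ⟺ `κ ≠ 1`)** (CM, general `μ(Ė)`).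
[cite: Lemmermeyer1995, §2 Proposition 1 c) with Theorem 1 ((i) 2: « $\alpha\OO_K = \mathfrak a^2$ », (b) « $Q(L) = 1$ and $\kappa_{L/K} = \langle [\mathfrak a]\rangle$, if $\mathfrak a$ is not principal »), general `μ(Ė)`; proved here] -/
theorem isSquare_spanSingleton_iff_ker_ne_bot_of_forall_pos_isSquare [IsCMField K]
    (hpos : ∀ u : (𝓞 F₀)ˣ, (∀ φ : F₀ →+* ℝ, 0 < φ ((u : 𝓞 F₀) : F₀)) → ∃ t : (𝓞 F₀)ˣ, u = t ^ 2)
    {η : Kˣ} (hη : IsOfFinOrder η) (hns : ¬ ∃ ξ : Kˣ, IsOfFinOrder ξ ∧ η = ξ ^ 2) {k₁ : Kˣ}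
    (hk₁ : k₁ * (Units.map (c : K →+* K).toMonoidHom k₁)⁻¹ = η) {d : F₀ˣ}
    (hd : algebraMap F₀ K (d : F₀) = (k₁ : K) * c (k₁ : K)) :
    IsSquare (FractionalIdeal.spanSingleton (𝓞 F₀)⁰ (d : F₀)) ↔ (ClassGroup.extendedHom (𝓞 F₀) (𝓞 K)).ker ≠ ⊥ := by
  rw [isSquare_spanSingleton_iff_forall_not_odd (K := K) d,
    forall_not_odd_iff_ker_ne_bot_of_forall_pos_isSquare c h2 hc hTR hpos hη hns hk₁ hd]

include h2 hc hTR in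
/-- **TOTALLY POSITIVE UNITS SQUARES ⇒ THE SQUARE-ROOT IDEAL IS NEVER PRINCIPAL, AND `κ = ⟨[J]⟩`** (CM, general
`μ(Ė)`): if `(N k₁)𝓞_Ḟ = J²` then `J` is not principal (M109: `J` principal ⟺ `Q = 2`) and the capitulation kernel is
generated by `[J]` — for such `Ḟ` only Theorem 1's sub-case 2 (b) occurs.
[cite: Lemmermeyer1995, §2 Proposition 1 c) with Theorem 1 ((i) 2 (b) / (ii) 2 (b): « $Q(L) = 1$ and $\kappa_{L/K} = \langle [\mathfrak a]\rangle$, if $\mathfrak a$ is not principal » / « $Q(L) = 1$, $\kappa_{L/K} = \langle [\mathfrak b]\rangle$, if $\mathfrak b$ is not principal »), general `μ(Ė)`; proved here] -/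
theorem not_isPrincipal_and_ker_eq_zpowers_of_forall_pos_isSquare [IsCMField K]
    (hpos : ∀ u : (𝓞 F₀)ˣ, (∀ φ : F₀ →+* ℝ, 0 < φ ((u : 𝓞 F₀) : F₀)) → ∃ t : (𝓞 F₀)ˣ, u = t ^ 2)
    {η : Kˣ} (hη : IsOfFinOrder η) (hns : ¬ ∃ ξ : Kˣ, IsOfFinOrder ξ ∧ η = ξ ^ 2) {k₁ : Kˣ}
    (hk₁ : k₁ * (Units.map (c : K →+* K).toMonoidHom k₁)⁻¹ = η) {d : F₀ˣ}
    (hd : algebraMap F₀ K (d : F₀) = (k₁ : K) * c (k₁ : K)) {J : FractionalIdeal (𝓞 F₀)⁰ F₀}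
    (hJ : FractionalIdeal.spanSingleton (𝓞 F₀)⁰ (d : F₀) = J * J) (hJ0 : J ≠ 0) :
    ¬ (J : Submodule (𝓞 F₀) F₀).IsPrincipal ∧
      (ClassGroup.extendedHom (𝓞 F₀) (𝓞 K)).ker = Subgroup.zpowers (ClassGroup.mk F₀ (Units.mk0 J hJ0)) := by
  have hnp : ¬ (J : Submodule (𝓞 F₀) F₀).IsPrincipal := by
    rw [← indexRealUnits_eq_two_iff_isPrincipal c h2 hc hTR hη hns hk₁ hd hJ,
      indexRealUnits_eq_one_of_forall_pos_isSquare c h2 hc hTR hpos]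
    decide
  exact ⟨hnp, (indexRealUnits_eq_one_and_ker_eq_zpowers_of_not_isPrincipal c h2 hc hTR hη hns hk₁ hd hJ hJ0 hnp).2.1⟩

include h2 hc hTR in
/-- **TOTALLY POSITIVE UNITS SQUARES AND `h_Ḟ` ODD ⇒ `W_odd ≠ ∅` FOR EVERY CM QUADRATIC `Ė/Ḟ`** (general `μ(Ė)`):
`Q = 1` (Prop. 1 c)) and `κ = 1` (odd class number), so by Theorem 1 some `ord_v(N k₁)` is odd — `(N k₁)𝓞_Ḟ` is never
an ideal square; in case (i) (`√-1 ∉ Ė`): every such `Ė/Ḟ` is essentially ramified.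
[cite: Lemmermeyer1995, §2 Proposition 1 c) with Theorem 1 (1: « If $L/K$ is essentially ramified, then $Q(L) = 1$, and $\kappa_{L/K} = 1$. », the converse for odd `h_K` from 2 (a)/(b)), general `μ(Ė)`; proved here] -/
theorem exists_odd_of_odd_classNumber_of_forall_pos_isSquare [IsCMField K]
    (hpos : ∀ u : (𝓞 F₀)ˣ, (∀ φ : F₀ →+* ℝ, 0 < φ ((u : 𝓞 F₀) : F₀)) → ∃ t : (𝓞 F₀)ˣ, u = t ^ 2)
    (hodd : Odd (NumberField.classNumber F₀)) {η : Kˣ} (hη : IsOfFinOrder η)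
    (hns : ¬ ∃ ξ : Kˣ, IsOfFinOrder ξ ∧ η = ξ ^ 2) {k₁ : Kˣ}
    (hk₁ : k₁ * (Units.map (c : K →+* K).toMonoidHom k₁)⁻¹ = η) {d : F₀ˣ}
    (hd : algebraMap F₀ K (d : F₀) = (k₁ : K) * c (k₁ : K)) :
    ∃ w : HeightOneSpectrum (𝓞 K), Odd (WithZero.log ((w.under (𝓞 F₀)).valuation F₀ (d : F₀))) :=
  (indexRealUnits_eq_one_iff_exists_odd_of_odd_classNumber c h2 hc hTR hodd hη hns hk₁ hd).mp
    (indexRealUnits_eq_one_of_forall_pos_isSquare c h2 hc hTR hpos)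

include h2 hc hTR in
/-- **… and `(N k₁)𝓞_Ḟ` IS NOT AN IDEAL SQUARE** (same hypotheses).
[cite: Lemmermeyer1995, §2 Proposition 1 c) with Theorem 1 ((i) 2 « $\alpha\OO_K = \mathfrak a^2$ » excluded for odd `h_K` and `Q = 1`), general `μ(Ė)`; proved here] -/
theorem not_isSquare_spanSingleton_of_odd_classNumber_of_forall_pos_isSquare [IsCMField K]
    (hpos : ∀ u : (𝓞 F₀)ˣ, (∀ φ : F₀ →+* ℝ, 0 < φ ((u : 𝓞 F₀) : F₀)) → ∃ t : (𝓞 F₀)ˣ, u = t ^ 2)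
    (hodd : Odd (NumberField.classNumber F₀)) {η : Kˣ} (hη : IsOfFinOrder η)
    (hns : ¬ ∃ ξ : Kˣ, IsOfFinOrder ξ ∧ η = ξ ^ 2) {k₁ : Kˣ}
    (hk₁ : k₁ * (Units.map (c : K →+* K).toMonoidHom k₁)⁻¹ = η) {d : F₀ˣ}
    (hd : algebraMap F₀ K (d : F₀) = (k₁ : K) * c (k₁ : K)) :
    ¬ IsSquare (FractionalIdeal.spanSingleton (𝓞 F₀)⁰ (d : F₀)) := by
  rw [← indexRealUnits_eq_two_iff_isSquare_spanSingleton_of_odd_classNumber c h2 hc hTR hodd hη hns hk₁ hd,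
    indexRealUnits_eq_one_of_forall_pos_isSquare c h2 hc hTR hpos]
  decide

include h2 hc hTR in
/-- **THEOREM 1 (ii) UNDER PROP. 1 c) AND ODD `h_Ḟ`: SOME FINITE `v` OF `Ḟ` HAS `2^(m-1) ∤ ord_v(2)`** whenever a CM
quadratic `Ė/Ḟ` contains a primitive `2^m`-th but no primitive `2^(m+1)`-th root of unity (`m ≥ 2`): `Q = 1 = #κ`
forces `π_m𝓞_Ḟ` not to be an ideal square (M109 (5)/(7)).  (`Ḟ = ℚ`, `Ė = ℚ(i)`, `m = 2`: `ord₂(2) = 1` is odd.)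
[cite: Lemmermeyer1995, §2 Proposition 1 c) with Theorem 1 (ii) (1: « if $\pi_m\OO_K$ is not an ideal square, then $Q(L) = 1$ and $\kappa_{L/K} = 1$ », 2 excluded), made place-wise through NeukirchANT1999 Ch. I (10.1); proved here] -/
theorem exists_not_two_pow_dvd_of_odd_classNumber_of_forall_pos_isSquare [IsCMField K]
    (hpos : ∀ u : (𝓞 F₀)ˣ, (∀ φ : F₀ →+* ℝ, 0 < φ ((u : 𝓞 F₀) : F₀)) → ∃ t : (𝓞 F₀)ˣ, u = t ^ 2)
    (hodd : Odd (NumberField.classNumber F₀)) {ζ : K} {m : ℕ} (hm : 2 ≤ m)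
    (hζ : IsPrimitiveRoot ζ (2 ^ m)) (hno : ¬ ∃ ξ : K, IsPrimitiveRoot ξ (2 ^ (m + 1))) :
    ∃ v : HeightOneSpectrum (𝓞 F₀), ¬ (2 : ℤ) ^ (m - 1) ∣ WithZero.log (v.valuation F₀ (2 : F₀)) := by
  by_contra h
  simp only [not_exists, not_not] at h
  have h2' := (indexRealUnits_eq_two_iff_forall_two_pow_dvd_of_odd_classNumber c h2 hc hTR hodd hm hζ hno).mpr h
  rw [indexRealUnits_eq_one_of_forall_pos_isSquare c h2 hc hTR hpos] at h2'
  exact absurd h2' (by decide)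

include h2 hc hTR in
/-- **THE LOCAL DATA UNDER PROP. 1 c) AND ODD `h_Ḟ`: EXISTS ⟺ SQ(V) FOR EVERY `c`-FIXED `V` MISSING `W_odd`** (CM,
general `μ(Ė)`): `Q = 1` by Prop. 1 c), `κ = 1` by the odd class number, so M109's second criterion applies — the
Book's requirement on `Ż_{∞,u}` beyond the squares is VOID off `W_odd` for every CM quadratic extension of such an `Ḟ`.
[cite: Arthur2011Draft, d-p.309/310 Lemma 6.2.2, abelian case `Ġ = T`, general `μ(Ė)` and `V`, `Ḟ` with odd `h_Ḟ` whose totally positive units are squares (Lemmermeyer1995 §2 Proposition 1 c)); proved here] -/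
theorem exists_isAutomorphic_localData_iff_sq_of_odd_classNumber_of_forall_pos_isSquare [IsCMField K]
    (hpos : ∀ u : (𝓞 F₀)ˣ, (∀ φ : F₀ →+* ℝ, 0 < φ ((u : 𝓞 F₀) : F₀)) → ∃ t : (𝓞 F₀)ˣ, u = t ^ 2)
    (hodd : Odd (NumberField.classNumber F₀)) {η : Kˣ}
    (hη : IsOfFinOrder η) (hns : ¬ ∃ ξ : Kˣ, IsOfFinOrder ξ ∧ η = ξ ^ 2) {k₁ : Kˣ}
    (hk₁ : k₁ * (Units.map (c : K →+* K).toMonoidHom k₁)⁻¹ = η) {d : F₀ˣ}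
    (hd : algebraMap F₀ K (d : F₀) = (k₁ : K) * c (k₁ : K))
    (e : InfinitePlace K → ℤ)
    {V : Finset (HeightOneSpectrum (𝓞 K))} (hV : ∀ u ∈ V, c • u = u)
    (hVW : ∀ u ∈ V, ¬ Odd (WithZero.log ((u.under (𝓞 F₀)).valuation F₀ (d : F₀))))
    (π : (u : HeightOneSpectrum (𝓞 K)) → ((u.adicCompletion K)ˣ →* ℂˣ))
    (hπc : ∀ u ∈ V, Continuous (π u)) (hπu : ∀ u ∈ V, ∀ x, ‖(π u x : ℂ)‖ = 1)
    (hπF : ∀ u ∈ V, ∀ a : ideleGroup F₀, π u (cpt u (AdeleRing.ideleBaseChange F₀ K a)) = 1) :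
    (∃ (ψ : torus c →ₜ* ℂˣ) (hψ : IsAutomorphic c ψ),
      (∀ u ∈ V, (pullback c h2 hc ψ hψ).localComponent u = π u) ∧
      (pullback c h2 hc ψ hψ).HasUnitaryArchType (fun w => 2 * e w) (fun _ => 0) ∧
      ∀ u : HeightOneSpectrum (𝓞 K), u ∉ V → (pullback c h2 hc ψ hψ).IsUnramifiedAt u) ↔
    (∀ ζ : Kˣ, IsOfFinOrder ζ →
      (∏ w : InfinitePlace K, (w.embedding ((ζ : K) * (c (ζ : K))⁻¹)) ^ (e w)) *
        ∏ u ∈ V, (π u (cpt u (GaloisRepresentations.principalIdele K ζ)) : ℂ) = 1) :=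
  exists_isAutomorphic_localData_iff_sq_of_indexRealUnits_eq_one_of_odd_classNumber c h2 hc hTR hodd hη hns hk₁ hd
    (indexRealUnits_eq_one_of_forall_pos_isSquare c h2 hc hTR hpos) e hV hVW π hπc hπu hπF

end Signatures

/-! ### (4) `Ḟ = ℚ`: the hypothesis of Prop. 1 c) holds; every imaginary quadratic field has `W_odd ≠ ∅` -/

section RationalBase

open Literature.NumberTheory.GaloisRepresentations.HeckeCharacter
open Literature.NumberTheory.GaloisRepresentations.HeckeCharacter.CMQuadraticExtension

/-- **OVER `ℚ` THE TOTALLY POSITIVE UNITS ARE SQUARES**: `𝓞_ℚ^× = {±1}` (Mathlib's `Rat.ringOfIntegersEquiv`,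
`Int.units_eq_one_or`), `-1` is negative under `ℚ ⊂ ℝ`, and `1 = 1²` — `ℚ` « contains units with any given signature ».
[cite: Lemmermeyer1995, §2 Proposition 1 c) (hypothesis « $L^+$ contains units with any given signature », for $L^+ = \Q$); proved here] -/
theorem forall_units_rat_eq_sq_of_pos (u : (𝓞 ℚ)ˣ) (hu : ∀ φ : ℚ →+* ℝ, 0 < φ ((u : 𝓞 ℚ) : ℚ)) :
    ∃ t : (𝓞 ℚ)ˣ, u = t ^ 2 := by
  rcases Int.units_eq_one_or (Units.map (Rat.ringOfIntegersEquiv : 𝓞 ℚ →* ℤ) u) with h | h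
  · have h1 := congrArg Units.val h
    rw [Units.coe_map, MonoidHom.coe_coe, Units.val_one] at h1
    refine ⟨1, ?_⟩
    rw [one_pow]
    apply Units.ext
    apply Rat.ringOfIntegersEquiv.injective
    rw [h1, Units.val_one, map_one]
  · exfalso
    have h1 := congrArg Units.val h
    rw [Units.coe_map, MonoidHom.coe_coe, Units.val_neg, Units.val_one] at h1
    have hval : ((u : 𝓞 ℚ) : ℚ) = -1 := by
      rw [RingOfIntegers.coe_eq_algebraMap, ← Rat.ringOfIntegersEquiv_apply_coe, h1]
      norm_num
    have := hu (Rat.castHom ℝ)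
    rw [hval, map_neg, map_one] at this
    linarith

variable {E : Type} [Field E] [NumberField E] (σ : E ≃ₐ[ℚ] E) (hE : Module.finrank ℚ E = 2) (hσ : σ ≠ 1)

include hE hσ in
/-- **OVER `ℚ`: `W_odd ≠ ∅` FOR EVERY IMAGINARY QUADRATIC FIELD, WHATEVER `μ(Ė)`** — for `Ė = ℚ(k₁)` with
`η = k₁ / σ k₁` generating `μ(Ė)/μ(Ė)²`, some prime `p` has `ord_p(N k₁)` odd (`Q(Ė) = 1`, M107
`indexRealUnits_eq_one_rat'`; `h_ℚ = 1`, Mathlib's `Rat.classNumber_eq`; M109 (7)).  E.g. `ℚ(i)`: `η = i`, `k₁ = 1 + i`,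
`N k₁ = 2`; `ℚ(√-3)`: `η = -1`, `k₁ = √-3`, `N k₁ = 3`.
[cite: Lemmermeyer1995, §2 Theorem 1 (1, with the converse for odd `h_K`; over `K = ℚ`, `Q = 1`), general `μ(Ė)`; proved here] -/
theorem exists_odd_rat [IsCMField E] {η : Eˣ} (hη : IsOfFinOrder η)
    (hns : ¬ ∃ ξ : Eˣ, IsOfFinOrder ξ ∧ η = ξ ^ 2) {k₁ : Eˣ}
    (hk₁ : k₁ * (Units.map (σ : E →+* E).toMonoidHom k₁)⁻¹ = η) {d : ℚˣ}
    (hd : algebraMap ℚ E (d : ℚ) = (k₁ : E) * σ (k₁ : E)) :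
    ∃ w : HeightOneSpectrum (𝓞 E), Odd (WithZero.log ((w.under (𝓞 ℚ)).valuation ℚ (d : ℚ))) := by
  have hodd : Odd (NumberField.classNumber ℚ) := by rw [Rat.classNumber_eq]; exact odd_one
  exact (indexRealUnits_eq_one_iff_exists_odd_of_odd_classNumber σ hE hσ (inferInstance : IsTotallyReal ℚ) hodd hη
    hns hk₁ hd).mp (indexRealUnits_eq_one_rat' σ hE hσ)

include hE hσ in
/-- **OVER `ℚ`: `(N k₁)ℤ` IS NEVER AN IDEAL SQUARE** (same setting).
[cite: Lemmermeyer1995, §2 Theorem 1 ((i) 2 « $\alpha\OO_K = \mathfrak a^2$ » excluded over `K = ℚ`), general `μ(Ė)`; proved here] -/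
theorem not_isSquare_spanSingleton_rat [IsCMField E] {η : Eˣ} (hη : IsOfFinOrder η)
    (hns : ¬ ∃ ξ : Eˣ, IsOfFinOrder ξ ∧ η = ξ ^ 2) {k₁ : Eˣ}
    (hk₁ : k₁ * (Units.map (σ : E →+* E).toMonoidHom k₁)⁻¹ = η) {d : ℚˣ}
    (hd : algebraMap ℚ E (d : ℚ) = (k₁ : E) * σ (k₁ : E)) :
    ¬ IsSquare (FractionalIdeal.spanSingleton (𝓞 ℚ)⁰ (d : ℚ)) := by
  have hodd : Odd (NumberField.classNumber ℚ) := by rw [Rat.classNumber_eq]; exact odd_one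
  rw [← indexRealUnits_eq_two_iff_isSquare_spanSingleton_of_odd_classNumber σ hE hσ (inferInstance : IsTotallyReal ℚ)
    hodd hη hns hk₁ hd, indexRealUnits_eq_one_rat' σ hE hσ]
  decide

end RationalBase

section SignatureCount

open NumberField.InfinitePlace NumberField.Units

variable (hTR : IsTotallyReal F₀)

/-! ### (5) (v1.1) THE SIGNATURE COUNT: units of every signature ⇒ totally positive units are squares -/

/-- The parity of the sign is additive: for nonzero reals `a`, `b`, `ab < 0` iff exactly one of them is negative.
[folklore] (proved here; private helper) -/
private theorem ite_mul_neg_eq_add_tc {a b : ℝ} (ha : a ≠ 0) (hb : b ≠ 0) :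
    (if a * b < 0 then (1 : ZMod 2) else 0) =
      (if a < 0 then (1 : ZMod 2) else 0) + (if b < 0 then (1 : ZMod 2) else 0) := by
  rcases ha.lt_or_gt with ha | ha <;> rcases hb.lt_or_gt with hb | hb
  · rw [if_neg (not_lt.mpr (mul_pos_of_neg_of_neg ha hb).le), if_pos ha, if_pos hb]; decide
  · rw [if_pos (mul_neg_of_neg_of_pos ha hb), if_pos ha, if_neg (not_lt.mpr hb.le), add_zero]
  · rw [if_pos (mul_neg_of_pos_of_neg ha hb), if_neg (not_lt.mpr ha.le), if_pos hb, zero_add]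
  · rw [if_neg (not_lt.mpr (mul_pos ha hb).le), if_neg (not_lt.mpr ha.le), if_neg (not_lt.mpr hb.le), add_zero]

/-- In a commutative group, changing the exponents of `m^s · ∏ fᵢ^{bᵢ}` by EVEN amounts changes the element by a
square.  [folklore] (proved here; private helper) -/
private theorem zpow_mul_prod_eq_mul_sq_tc {G : Type*} [CommGroup G] {r : ℕ} (m : G) (f : Fin r → G)
    {s s' : ℤ} {b b' : Fin r → ℤ} (hs : Even (s - s')) (hb : ∀ i, Even (b i - b' i)) :
    ∃ y : G, m ^ s * ∏ i, f i ^ b i = (m ^ s' * ∏ i, f i ^ b' i) * y ^ 2 := by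
  obtain ⟨q, hq⟩ := hs
  choose e he using hb
  obtain rfl : s = s' + (q + q) := by omega
  obtain rfl : b = fun i => b' i + (e i + e i) := funext fun i => by have := he i; omega
  refine ⟨m ^ q * ∏ i, f i ^ e i, ?_⟩
  simp only [zpow_add, Finset.prod_mul_distrib, sq]
  simp only [mul_assoc, mul_comm, mul_left_comm]

/-- In a totally real number field the roots of unity are `±1`: a root of unity has absolute value `1` under a REAL
embedding, hence is `±1` there, hence is `±1`.  [folklore] (proved here; private helper) -/
private theorem coe_torsion_eq_one_or_eq_neg_one_tc (hTR : IsTotallyReal F₀) (ζ : torsion F₀) :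
    (ζ : (𝓞 F₀)ˣ) = 1 ∨ (ζ : (𝓞 F₀)ˣ) = -1 := by
  obtain ⟨w⟩ := (inferInstance : Nonempty (InfinitePlace F₀))
  have hw : w.IsReal := hTR.isReal w
  have h1 : w ((ζ : (𝓞 F₀)ˣ) : F₀) = 1 := (NumberField.Units.mem_torsion F₀).mp ζ.2 w
  rw [← norm_embedding_of_isReal hw, Real.norm_eq_abs, abs_eq (zero_le_one' ℝ)] at h1
  rcases h1 with h | h
  · left
    apply NumberField.Units.coe_injective F₀
    show ((ζ : (𝓞 F₀)ˣ) : F₀) = ((1 : (𝓞 F₀)ˣ) : F₀)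
    rw [NumberField.Units.coe_one]
    exact (embedding_of_isReal hw).injective (h.trans (map_one _).symm)
  · right
    apply NumberField.Units.coe_injective F₀
    show ((ζ : (𝓞 F₀)ˣ) : F₀) = ((-1 : (𝓞 F₀)ˣ) : F₀)
    rw [NumberField.Units.coe_neg_one]
    exact (embedding_of_isReal hw).injective (h.trans (by rw [map_neg, map_one]))

omit [NumberField F₀] in
/-- The real embeddings attached to distinct (real) places are distinct.  [folklore] (proved here; private helper) -/
private theorem eq_of_embedding_of_isReal_eq_tc (hTR : IsTotallyReal F₀) {w w' : InfinitePlace F₀}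
    (h : embedding_of_isReal (hTR.isReal w) = embedding_of_isReal (hTR.isReal w')) : w = w' := by
  have : embedding w = embedding w' := by
    ext x
    rw [← embedding_of_isReal_apply (hTR.isReal w) x, ← embedding_of_isReal_apply (hTR.isReal w') x, h]
  rw [← mk_embedding w, this, mk_embedding]

omit [NumberField F₀] in
/-- « units with any given signature », read on the real places: for every `g : places → 𝔽₂` there is a unit negative
exactly where `g = 1`.  [folklore] (proved here; private helper) -/
private theorem exists_units_neg_iff_tc (hTR : IsTotallyReal F₀)
    (hsig : ∀ S : Set (F₀ →+* ℝ), ∃ u : (𝓞 F₀)ˣ, ∀ φ : F₀ →+* ℝ, φ ((u : 𝓞 F₀) : F₀) < 0 ↔ φ ∈ S)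
    (g : InfinitePlace F₀ → ZMod 2) :
    ∃ u : (𝓞 F₀)ˣ, ∀ w : InfinitePlace F₀,
      embedding_of_isReal (hTR.isReal w) ((u : 𝓞 F₀) : F₀) < 0 ↔ g w = 1 := by
  obtain ⟨u, hu⟩ := hsig {φ | ∃ w, g w = 1 ∧ embedding_of_isReal (hTR.isReal w) = φ}
  refine ⟨u, fun w => ?_⟩
  rw [hu]
  simp only [Set.mem_setOf_eq]
  constructor
  · rintro ⟨w', hw', he⟩
    exact eq_of_embedding_of_isReal_eq_tc hTR he ▸ hw'
  · exact fun h => ⟨w, h, rfl⟩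

include hTR in
/-- **THE SIGNATURE COUNT (DIRICHLET): IF `Ḟ` (TOTALLY REAL) CONTAINS UNITS WITH ANY GIVEN SIGNATURE, THEN EVERY TOTALLY
POSITIVE UNIT OF `Ḟ` IS A SQUARE IN `𝓞_Ḟ^×`** — the reduction sentence of Lemmermeyer's proof of Prop. 1 c) (« our
assumption implies that totally positive units are squares »).  PROOF: by Dirichlet's unit theorem (Mathlib's
`NumberField.Units.exist_unique_eq_mul_prod`) every unit is `± ∏ fᵢ^{bᵢ}` over a fundamental system `f₁, …, f_r`,
`r = n - 1`, `n` = the number of (real) places, the roots of unity of the totally real `Ḟ` being `±1`; the signature of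
`(-1)^s ∏ fᵢ^{bᵢ}` depends only on the parities `(s̄, b̄) ∈ 𝔽₂ × 𝔽₂^r`, giving a map `Ψ : 𝔽₂ × 𝔽₂^r → 𝔽₂^{places}`
between finite sets of the same cardinality `2^n`; the hypothesis says `Ψ` is onto, hence it is one-to-one; a totally
positive unit `u = (-1)^s ∏ fᵢ^{bᵢ}` has `Ψ(s̄, b̄) = 0 = Ψ(0, 0)`, so `s` and all `bᵢ` are even and `u` is a square.
[cite: Lemmermeyer1995, §2 Proposition 1 c) proof (« our assumption implies that totally positive units are squares » — the hypothesis being « $L^+$ contains units with any given signature »); proved here (Dirichlet's unit theorem through Mathlib)] -/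
theorem forall_units_eq_sq_of_pos_of_signatures
    (hsig : ∀ S : Set (F₀ →+* ℝ), ∃ u : (𝓞 F₀)ˣ, ∀ φ : F₀ →+* ℝ, φ ((u : 𝓞 F₀) : F₀) < 0 ↔ φ ∈ S)
    (u : (𝓞 F₀)ˣ) (hu : ∀ φ : F₀ →+* ℝ, 0 < φ ((u : 𝓞 F₀) : F₀)) : ∃ t : (𝓞 F₀)ˣ, u = t ^ 2 := by
  classical
  -- the real embeddings of the places, the parity presentation of the units, the signature in `𝔽₂^{places}`
  let e : InfinitePlace F₀ → (F₀ →+* ℝ) := fun w => embedding_of_isReal (hTR.isReal w)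
  let U : ℤ → (Fin (rank F₀) → ℤ) → (𝓞 F₀)ˣ := fun s b => (-1) ^ s * ∏ i, fundSystem F₀ i ^ b i
  let σ : (𝓞 F₀)ˣ → InfinitePlace F₀ → ZMod 2 := fun x w => if e w ((x : 𝓞 F₀) : F₀) < 0 then 1 else 0
  let Ψ : ZMod 2 × (Fin (rank F₀) → ZMod 2) → InfinitePlace F₀ → ZMod 2 :=
    fun p => σ (U (p.1.val : ℤ) (fun i => ((p.2 i).val : ℤ)))
  have hne : ∀ (x : (𝓞 F₀)ˣ) (w : InfinitePlace F₀), e w ((x : 𝓞 F₀) : F₀) ≠ 0 := fun x w => by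
    rw [map_ne_zero_iff _ (e w).injective, RingOfIntegers.coe_eq_algebraMap]
    exact NumberField.Units.coe_ne_zero x
  -- `σ` is additive and kills squares
  have hσmul : ∀ x y : (𝓞 F₀)ˣ, σ (x * y) = σ x + σ y := fun x y => by
    funext w
    simp only [σ, Pi.add_apply, Units.val_mul, RingOfIntegers.coe_eq_algebraMap, map_mul]
    exact ite_mul_neg_eq_add_tc (hne x w) (hne y w)
  have hσsq : ∀ y : (𝓞 F₀)ˣ, σ (y ^ 2) = 0 := fun y => by
    funext w
    simp only [σ, Pi.zero_apply, Units.val_pow_eq_pow_val, RingOfIntegers.coe_eq_algebraMap, map_pow]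
    exact if_neg (not_lt.mpr (sq_nonneg _))
  -- the signature of `(-1)^s ∏ fᵢ^{bᵢ}` depends only on the parities
  have hσU : ∀ (s : ℤ) (b : Fin (rank F₀) → ℤ), σ (U s b) = Ψ ((s : ZMod 2), fun i => ((b i : ℤ) : ZMod 2)) :=
    fun s b => by
    have hs : Even (s - (((s : ZMod 2)).val : ℤ)) := ⟨s / 2, by rw [ZMod.val_intCast]; omega⟩
    have hb : ∀ i, Even (b i - ((((b i : ℤ) : ZMod 2)).val : ℤ)) := fun i =>
      ⟨b i / 2, by rw [ZMod.val_intCast]; omega⟩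
    obtain ⟨y, hy⟩ := zpow_mul_prod_eq_mul_sq_tc (-1 : (𝓞 F₀)ˣ) (fundSystem F₀) hs hb
    change σ ((-1) ^ s * ∏ i, fundSystem F₀ i ^ b i) =
      σ ((-1) ^ (((s : ZMod 2)).val : ℤ) * ∏ i, fundSystem F₀ i ^ ((((b i : ℤ) : ZMod 2)).val : ℤ))
    rw [hy, hσmul, hσsq, add_zero]
  -- every unit is some `(-1)^s ∏ fᵢ^{bᵢ}` (Dirichlet; the torsion of the totally real `Ḟ` is `±1`)
  have hdec : ∀ x : (𝓞 F₀)ˣ, ∃ (s : ℤ) (b : Fin (rank F₀) → ℤ), x = U s b := fun x => by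
    obtain ⟨⟨ζ, b⟩, hx, -⟩ := exist_unique_eq_mul_prod F₀ x
    rcases coe_torsion_eq_one_or_eq_neg_one_tc hTR ζ with h1 | h1
    · refine ⟨0, b, ?_⟩
      change x = (-1) ^ (0 : ℤ) * ∏ i, fundSystem F₀ i ^ b i
      rw [zpow_zero, ← h1]; exact hx
    · refine ⟨1, b, ?_⟩
      change x = (-1) ^ (1 : ℤ) * ∏ i, fundSystem F₀ i ^ b i
      rw [zpow_one, ← h1]; exact hx
  -- the hypothesis: `Ψ` is onto
  have hsurj : Function.Surjective Ψ := fun g => by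
    obtain ⟨x, hx⟩ := exists_units_neg_iff_tc hTR hsig g
    have hσx : σ x = g := by
      funext w
      by_cases hg : g w = 1
      · rw [hg]; exact if_pos ((hx w).mpr hg)
      · have hg0 : g w = 0 := by
          rcases (by decide : ∀ z : ZMod 2, z = 0 ∨ z = 1) (g w) with h | h
          · exact h
          · exact absurd h hg
        rw [hg0]; exact if_neg (fun h => hg ((hx w).mp h))
    obtain ⟨s, b, rfl⟩ := hdec x
    exact ⟨((s : ZMod 2), fun i => ((b i : ℤ) : ZMod 2)), (hσU s b).symm.trans hσx⟩
  -- both sides have `2^n` elements, `n = #places = r + 1`; so `Ψ` is one-to-one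
  have hcard : Fintype.card (ZMod 2 × (Fin (rank F₀) → ZMod 2)) = Fintype.card (InfinitePlace F₀ → ZMod 2) := by
    rw [Fintype.card_prod, Fintype.card_fun, Fintype.card_fun, ZMod.card, Fintype.card_fin, ← pow_succ']
    congr 1
    change Fintype.card (InfinitePlace F₀) - 1 + 1 = _
    exact Nat.sub_add_cancel Fintype.card_pos
  have hinj : Function.Injective Ψ :=
    (Finite.injective_iff_surjective_of_equiv (Fintype.equivOfCardEq hcard)).mpr hsurj
  -- a totally positive unit has the parities of `1`
  obtain ⟨s, b, hsb⟩ := hdec u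
  have hσu : σ u = 0 := by
    funext w
    exact if_neg (not_lt.mpr (hu (e w)).le)
  have hσ1 : σ 1 = 0 := by
    funext w
    simp only [σ, Pi.zero_apply, Units.val_one, RingOfIntegers.coe_eq_algebraMap, map_one]
    exact if_neg (not_lt.mpr zero_le_one)
  have hU0 : U 0 (fun _ => 0) = 1 := by
    change (-1 : (𝓞 F₀)ˣ) ^ (0 : ℤ) * ∏ i, fundSystem F₀ i ^ (0 : ℤ) = 1
    rw [zpow_zero, one_mul]
    exact Finset.prod_eq_one fun i _ => zpow_zero _
  have hkey : ((s : ZMod 2), fun i => ((b i : ℤ) : ZMod 2)) = ((0 : ZMod 2), fun _ => (0 : ZMod 2)) := by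
    apply hinj
    have h00 := hσU 0 (fun _ => 0)
    rw [hU0, hσ1] at h00
    rw [← hσU s b, ← hsb, hσu]
    simpa using h00
  have hs0 : Even (s - 0) := by
    have := congrArg Prod.fst hkey
    simpa [ZMod.intCast_eq_zero_iff_even] using this
  have hb0 : ∀ i, Even (b i - 0) := fun i => by
    have := congrFun (congrArg Prod.snd hkey) i
    simpa [ZMod.intCast_eq_zero_iff_even] using this
  obtain ⟨y, hy⟩ := zpow_mul_prod_eq_mul_sq_tc (-1 : (𝓞 F₀)ˣ) (fundSystem F₀) hs0 hb0
  refine ⟨y, ?_⟩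
  rw [hsb]
  change (-1 : (𝓞 F₀)ˣ) ^ s * ∏ i, fundSystem F₀ i ^ b i = y ^ 2
  rw [hy]
  simp only [zpow_zero, Finset.prod_const_one, one_mul]

include h2 hc hTR in
/-- **LEMMERMEYER'S PROPOSITION 1 c) (HASSE'S SATZ 25) WITH ITS LITERAL HYPOTHESIS, GENERAL `μ(Ė)`.**  If the totally
real `Ḟ` contains units with any given signature — for every set `S` of real embeddings a unit negative exactly at
`S` — then `Q(Ė) = 1` for EVERY CM quadratic extension `Ė/Ḟ`: the signature count
(`forall_units_eq_sq_of_pos_of_signatures`) feeds (2) (`indexRealUnits_eq_one_of_forall_pos_isSquare`).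
[cite: Lemmermeyer1995, §2 Proposition 1 c) (« (Satz 25) If $L^+$ contains units with any given signature, then $Q(L) = 1$. »), general `μ(Ė)`; proved here] -/
theorem indexRealUnits_eq_one_of_signatures [IsCMField K]
    (hsig : ∀ S : Set (F₀ →+* ℝ), ∃ u : (𝓞 F₀)ˣ, ∀ φ : F₀ →+* ℝ, φ ((u : 𝓞 F₀) : F₀) < 0 ↔ φ ∈ S) :
    IsCMField.indexRealUnits K = 1 :=
  indexRealUnits_eq_one_of_forall_pos_isSquare c h2 hc hTR (forall_units_eq_sq_of_pos_of_signatures hTR hsig)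

include h2 hc hTR in
/-- **UNITS OF EVERY SIGNATURE ⇒ (`W_odd = ∅ ⟺ κ_{Ė/Ḟ} ≠ 1`)** (CM, general `μ(Ė)`; (3) with the literal hypothesis).
[cite: Lemmermeyer1995, §2 Proposition 1 c) with Theorem 1 ((i)/(ii) 2 (b): « $Q(L) = 1$ and $\kappa_{L/K} = \langle [\mathfrak a]\rangle$, if $\mathfrak a$ is not principal »), general `μ(Ė)`; proved here] -/
theorem forall_not_odd_iff_ker_ne_bot_of_signatures [IsCMField K]
    (hsig : ∀ S : Set (F₀ →+* ℝ), ∃ u : (𝓞 F₀)ˣ, ∀ φ : F₀ →+* ℝ, φ ((u : 𝓞 F₀) : F₀) < 0 ↔ φ ∈ S)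
    {η : Kˣ} (hη : IsOfFinOrder η) (hns : ¬ ∃ ξ : Kˣ, IsOfFinOrder ξ ∧ η = ξ ^ 2) {k₁ : Kˣ}
    (hk₁ : k₁ * (Units.map (c : K →+* K).toMonoidHom k₁)⁻¹ = η) {d : F₀ˣ}
    (hd : algebraMap F₀ K (d : F₀) = (k₁ : K) * c (k₁ : K)) :
    (∀ w : HeightOneSpectrum (𝓞 K), ¬ Odd (WithZero.log ((w.under (𝓞 F₀)).valuation F₀ (d : F₀)))) ↔
      (ClassGroup.extendedHom (𝓞 F₀) (𝓞 K)).ker ≠ ⊥ :=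
  forall_not_odd_iff_ker_ne_bot_of_forall_pos_isSquare c h2 hc hTR (forall_units_eq_sq_of_pos_of_signatures hTR hsig)
    hη hns hk₁ hd

include h2 hc hTR in
/-- **UNITS OF EVERY SIGNATURE AND `h_Ḟ` ODD ⇒ `W_odd ≠ ∅`** for every CM quadratic `Ė = Ḟ(k₁)`, general `μ(Ė)`
((3) with the literal hypothesis): some finite place of `Ḟ` has `ord_v(N k₁)` odd.
[cite: Lemmermeyer1995, §2 Proposition 1 c) with Theorem 1 ((i) 2: « $\alpha\OO_K = \mathfrak a^2$ », (b) « $Q(L) = 1$ and $\kappa_{L/K} = \langle [\mathfrak a]\rangle$, if $\mathfrak a$ is not principal »), general `μ(Ė)`; proved here] -/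
theorem exists_odd_of_odd_classNumber_of_signatures [IsCMField K]
    (hsig : ∀ S : Set (F₀ →+* ℝ), ∃ u : (𝓞 F₀)ˣ, ∀ φ : F₀ →+* ℝ, φ ((u : 𝓞 F₀) : F₀) < 0 ↔ φ ∈ S)
    (hodd : Odd (NumberField.classNumber F₀)) {η : Kˣ} (hη : IsOfFinOrder η)
    (hns : ¬ ∃ ξ : Kˣ, IsOfFinOrder ξ ∧ η = ξ ^ 2) {k₁ : Kˣ}
    (hk₁ : k₁ * (Units.map (c : K →+* K).toMonoidHom k₁)⁻¹ = η) {d : F₀ˣ}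
    (hd : algebraMap F₀ K (d : F₀) = (k₁ : K) * c (k₁ : K)) :
    ∃ w : HeightOneSpectrum (𝓞 K), Odd (WithZero.log ((w.under (𝓞 F₀)).valuation F₀ (d : F₀))) :=
  exists_odd_of_odd_classNumber_of_forall_pos_isSquare c h2 hc hTR (forall_units_eq_sq_of_pos_of_signatures hTR hsig)
    hodd hη hns hk₁ hd

include h2 hc hTR in
/-- **THE LOCAL DATA OFF `W_odd` OVER SUCH `Ḟ` (units of every signature, `h_Ḟ` odd): exists ⟺ SQ(V)** for every CM
quadratic `Ė/Ḟ`, every `μ(Ė)`, every `c`-fixed `V` missing `W_odd` — the Book's joint condition on `Ż_{∞,u}` requires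
nothing beyond the squares there ((3) with the literal hypothesis).
[cite: Arthur2011Draft, d-p.309/310 Lemma 6.2.2 (i)/(ii) (« For any valuation $v \notin S_\infty(u)$, $\dot\pi_v$ is spherical. »; the requirement on `Ż_{∞,u}` for `Ġ = T` over an `Ḟ` with units of every signature and odd class number, `V ⊉ W_odd`); proved here] -/
theorem exists_isAutomorphic_localData_iff_sq_of_odd_classNumber_of_signatures [IsCMField K]
    (hsig : ∀ S : Set (F₀ →+* ℝ), ∃ u : (𝓞 F₀)ˣ, ∀ φ : F₀ →+* ℝ, φ ((u : 𝓞 F₀) : F₀) < 0 ↔ φ ∈ S)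
    (hodd : Odd (NumberField.classNumber F₀)) {η : Kˣ}
    (hη : IsOfFinOrder η) (hns : ¬ ∃ ξ : Kˣ, IsOfFinOrder ξ ∧ η = ξ ^ 2) {k₁ : Kˣ}
    (hk₁ : k₁ * (Units.map (c : K →+* K).toMonoidHom k₁)⁻¹ = η) {d : F₀ˣ}
    (hd : algebraMap F₀ K (d : F₀) = (k₁ : K) * c (k₁ : K))
    (e : InfinitePlace K → ℤ)
    {V : Finset (HeightOneSpectrum (𝓞 K))} (hV : ∀ u ∈ V, c • u = u)
    (hVW : ∀ u ∈ V, ¬ Odd (WithZero.log ((u.under (𝓞 F₀)).valuation F₀ (d : F₀))))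
    (π : (u : HeightOneSpectrum (𝓞 K)) → ((u.adicCompletion K)ˣ →* ℂˣ))
    (hπc : ∀ u ∈ V, Continuous (π u)) (hπu : ∀ u ∈ V, ∀ x, ‖(π u x : ℂ)‖ = 1)
    (hπF : ∀ u ∈ V, ∀ a : ideleGroup F₀, π u (cpt u (AdeleRing.ideleBaseChange F₀ K a)) = 1) :
    (∃ (ψ : torus c →ₜ* ℂˣ) (hψ : IsAutomorphic c ψ),
      (∀ u ∈ V, (pullback c h2 hc ψ hψ).localComponent u = π u) ∧
      (pullback c h2 hc ψ hψ).HasUnitaryArchType (fun w => 2 * e w) (fun _ => 0) ∧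
      ∀ u : HeightOneSpectrum (𝓞 K), u ∉ V → (pullback c h2 hc ψ hψ).IsUnramifiedAt u) ↔
    (∀ ζ : Kˣ, IsOfFinOrder ζ →
      (∏ w : InfinitePlace K, (w.embedding ((ζ : K) * (c (ζ : K))⁻¹)) ^ (e w)) *
        ∏ u ∈ V, (π u (cpt u (GaloisRepresentations.principalIdele K ζ)) : ℂ) = 1) :=
  exists_isAutomorphic_localData_iff_sq_of_odd_classNumber_of_forall_pos_isSquare c h2 hc hTR
    (forall_units_eq_sq_of_pos_of_signatures hTR hsig) hodd hη hns hk₁ hd e hV hVW π hπc hπu hπF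

/-- **`ℚ` CONTAINS UNITS WITH ANY GIVEN SIGNATURE**: its one real embedding, and the units `1`, `-1`.
[cite: Lemmermeyer1995, §2 Proposition 1 c) (hypothesis « $L^+$ contains units with any given signature », for $L^+ = \Q$); proved here] -/
theorem exists_units_rat_neg_iff (S : Set (ℚ →+* ℝ)) :
    ∃ u : (𝓞 ℚ)ˣ, ∀ φ : ℚ →+* ℝ, φ ((u : 𝓞 ℚ) : ℚ) < 0 ↔ φ ∈ S := by
  classical
  by_cases hS : Rat.castHom ℝ ∈ S
  · refine ⟨-1, fun φ => ?_⟩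
    obtain rfl : φ = Rat.castHom ℝ := Subsingleton.elim _ _
    rw [Units.val_neg, Units.val_one, RingOfIntegers.coe_eq_algebraMap, map_neg, map_one, map_neg, map_one]
    exact ⟨fun _ => hS, fun _ => by norm_num⟩
  · refine ⟨1, fun φ => ?_⟩
    obtain rfl : φ = Rat.castHom ℝ := Subsingleton.elim _ _
    rw [Units.val_one, RingOfIntegers.coe_eq_algebraMap, map_one, map_one]
    exact ⟨fun h => absurd h (not_lt.mpr zero_le_one), fun h => absurd h hS⟩

omit [NumberField F₀] in
/-- Every real embedding of the totally real `Ḟ` is the embedding attached to a (real) place.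
[folklore] (proved here; private helper) -/
private theorem exists_embedding_of_isReal_eq_tc (hTR : IsTotallyReal F₀) (φ : F₀ →+* ℝ) :
    ∃ w : InfinitePlace F₀, embedding_of_isReal (hTR.isReal w) = φ := by
  have hψ : ComplexEmbedding.IsReal (Complex.ofRealHom.comp φ) :=
    ComplexEmbedding.isReal_iff.mpr (by
      ext x
      rw [ComplexEmbedding.conjugate_coe_eq, RingHom.comp_apply, Complex.ofRealHom_eq_coe, Complex.conj_ofReal])
  refine ⟨InfinitePlace.mk (Complex.ofRealHom.comp φ), ?_⟩
  ext x
  have h1 := embedding_of_isReal_apply (hTR.isReal (InfinitePlace.mk (Complex.ofRealHom.comp φ))) x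
  rw [embedding_mk_eq_of_isReal hψ, RingHom.comp_apply, Complex.ofRealHom_eq_coe] at h1
  exact Complex.ofReal_injective h1

include hTR in
/-- **THE COUNT READ BACKWARDS: IF EVERY TOTALLY POSITIVE UNIT OF THE TOTALLY REAL `Ḟ` IS A SQUARE IN `𝓞_Ḟ^×`, THEN `Ḟ`
CONTAINS UNITS WITH ANY GIVEN SIGNATURE** — so for totally real `Ḟ` Lemmermeyer's hypothesis of Prop. 1 c) and the
hypothesis of v1's (2) are EQUIVALENT.  PROOF: with the parity presentation `Ψ : 𝔽₂ × 𝔽₂^r → 𝔽₂^{places}` of the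
signature (as in `forall_units_eq_sq_of_pos_of_signatures`), if `Ψ(p) = Ψ(q)` then the unit `U(p)·U(q)` is totally
positive, hence a square `y²`; by the UNIQUENESS in Dirichlet's theorem (`exist_unique_eq_mul_prod`) its exponents
`pᵢ + qᵢ` over the fundamental system are the even numbers `2cᵢ` of `y²` and its sign `(-1)^{p₀+q₀}` is `ζ_y² = 1`;
with all `pᵢ, qᵢ ∈ {0, 1}` this forces `p = q`.  So `Ψ` is one-to-one between sets of size `2^n`, hence onto: every
sign pattern on the places is the signature of a unit, and every real embedding is the embedding of a place.
[cite: Lemmermeyer1995, §2 Proposition 1 c) (hypothesis « $L^+$ contains units with any given signature » versus the proof's « totally positive units are squares »: the converse implication, for totally real $L^+$); proved here (Dirichlet's unit theorem through Mathlib)] -/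
theorem exists_units_neg_iff_of_forall_pos_eq_sq
    (hpos : ∀ u : (𝓞 F₀)ˣ, (∀ φ : F₀ →+* ℝ, 0 < φ ((u : 𝓞 F₀) : F₀)) → ∃ t : (𝓞 F₀)ˣ, u = t ^ 2)
    (S : Set (F₀ →+* ℝ)) :
    ∃ u : (𝓞 F₀)ˣ, ∀ φ : F₀ →+* ℝ, φ ((u : 𝓞 F₀) : F₀) < 0 ↔ φ ∈ S := by
  classical
  -- the real embeddings of the places, the parity presentation of the units, the signature in `𝔽₂^{places}`
  let e : InfinitePlace F₀ → (F₀ →+* ℝ) := fun w => embedding_of_isReal (hTR.isReal w)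
  let U : ℤ → (Fin (rank F₀) → ℤ) → (𝓞 F₀)ˣ := fun s b => (-1) ^ s * ∏ i, fundSystem F₀ i ^ b i
  let σ : (𝓞 F₀)ˣ → InfinitePlace F₀ → ZMod 2 := fun x w => if e w ((x : 𝓞 F₀) : F₀) < 0 then 1 else 0
  let Ψ : ZMod 2 × (Fin (rank F₀) → ZMod 2) → InfinitePlace F₀ → ZMod 2 :=
    fun p => σ (U (p.1.val : ℤ) (fun i => ((p.2 i).val : ℤ)))
  have hne : ∀ (x : (𝓞 F₀)ˣ) (w : InfinitePlace F₀), e w ((x : 𝓞 F₀) : F₀) ≠ 0 := fun x w => by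
    rw [map_ne_zero_iff _ (e w).injective, RingOfIntegers.coe_eq_algebraMap]
    exact NumberField.Units.coe_ne_zero x
  -- `σ` is additive and kills squares
  have hσmul : ∀ x y : (𝓞 F₀)ˣ, σ (x * y) = σ x + σ y := fun x y => by
    funext w
    simp only [σ, Pi.add_apply, Units.val_mul, RingOfIntegers.coe_eq_algebraMap, map_mul]
    exact ite_mul_neg_eq_add_tc (hne x w) (hne y w)
  have hσsq : ∀ y : (𝓞 F₀)ˣ, σ (y ^ 2) = 0 := fun y => by
    funext w
    simp only [σ, Pi.zero_apply, Units.val_pow_eq_pow_val, RingOfIntegers.coe_eq_algebraMap, map_pow]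
    exact if_neg (not_lt.mpr (sq_nonneg _))
  -- the signature of `(-1)^s ∏ fᵢ^{bᵢ}` depends only on the parities
  have hσU : ∀ (s : ℤ) (b : Fin (rank F₀) → ℤ), σ (U s b) = Ψ ((s : ZMod 2), fun i => ((b i : ℤ) : ZMod 2)) :=
    fun s b => by
    have hs : Even (s - (((s : ZMod 2)).val : ℤ)) := ⟨s / 2, by rw [ZMod.val_intCast]; omega⟩
    have hb : ∀ i, Even (b i - ((((b i : ℤ) : ZMod 2)).val : ℤ)) := fun i =>
      ⟨b i / 2, by rw [ZMod.val_intCast]; omega⟩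
    obtain ⟨y, hy⟩ := zpow_mul_prod_eq_mul_sq_tc (-1 : (𝓞 F₀)ˣ) (fundSystem F₀) hs hb
    change σ ((-1) ^ s * ∏ i, fundSystem F₀ i ^ b i) =
      σ ((-1) ^ (((s : ZMod 2)).val : ℤ) * ∏ i, fundSystem F₀ i ^ ((((b i : ℤ) : ZMod 2)).val : ℤ))
    rw [hy, hσmul, hσsq, add_zero]
  -- every unit is some `(-1)^s ∏ fᵢ^{bᵢ}` (Dirichlet; the torsion of the totally real `Ḟ` is `±1`)
  have hdec : ∀ x : (𝓞 F₀)ˣ, ∃ (s : ℤ) (b : Fin (rank F₀) → ℤ), x = U s b := fun x => by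
    obtain ⟨⟨ζ, b⟩, hx, -⟩ := exist_unique_eq_mul_prod F₀ x
    rcases coe_torsion_eq_one_or_eq_neg_one_tc hTR ζ with h1 | h1
    · refine ⟨0, b, ?_⟩
      change x = (-1) ^ (0 : ℤ) * ∏ i, fundSystem F₀ i ^ b i
      rw [zpow_zero, ← h1]; exact hx
    · refine ⟨1, b, ?_⟩
      change x = (-1) ^ (1 : ℤ) * ∏ i, fundSystem F₀ i ^ b i
      rw [zpow_one, ← h1]; exact hx
  -- the hypothesis and Dirichlet's UNIQUENESS: `Ψ` is one-to-one
  have h1t : (-1 : (𝓞 F₀)ˣ) ∈ torsion F₀ :=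
    (CommGroup.mem_torsion _).mpr (isOfFinOrder_iff_pow_eq_one.mpr ⟨2, two_pos, neg_one_sq⟩)
  have hinj : Function.Injective Ψ := by
    rintro ⟨s₁, b₁⟩ ⟨s₂, b₂⟩ hΨ
    -- the unit `x = U(p) · U(q)` is totally positive, hence a square
    have hσx : σ (U (s₁.val : ℤ) (fun i => ((b₁ i).val : ℤ)) * U (s₂.val : ℤ) (fun i => ((b₂ i).val : ℤ))) = 0 := by
      rw [hσmul]
      change Ψ (s₁, b₁) + Ψ (s₂, b₂) = 0
      rw [hΨ]
      funext w
      exact (by decide : ∀ z : ZMod 2, z + z = 0) _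
    have hxpos : ∀ φ : F₀ →+* ℝ, 0 < φ (((U (s₁.val : ℤ) (fun i => ((b₁ i).val : ℤ)) *
        U (s₂.val : ℤ) (fun i => ((b₂ i).val : ℤ)) : (𝓞 F₀)ˣ) : 𝓞 F₀) : F₀) := fun φ => by
      obtain ⟨w, rfl⟩ := exists_embedding_of_isReal_eq_tc hTR φ
      have h0 := congrFun hσx w
      simp only [Pi.zero_apply] at h0
      rcases (hne _ w).lt_or_gt with hlt | hgt
      · exact absurd (h0.symm.trans (if_pos hlt)) (by decide)
      · exact hgt
    obtain ⟨y, hy⟩ := hpos _ hxpos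
    obtain ⟨⟨ζ, cy⟩, hyd, -⟩ := exist_unique_eq_mul_prod F₀ y
    -- the two Dirichlet normal forms of `x`
    have hxn : U (s₁.val : ℤ) (fun i => ((b₁ i).val : ℤ)) * U (s₂.val : ℤ) (fun i => ((b₂ i).val : ℤ)) =
        (((⟨(-1) ^ ((s₁.val : ℤ) + (s₂.val : ℤ)), Subgroup.zpow_mem _ h1t _⟩, fun i => ((b₁ i).val : ℤ) + ((b₂ i).val : ℤ)) :
          torsion F₀ × (Fin (rank F₀) → ℤ)).1 : (𝓞 F₀)ˣ) *
          ∏ i, fundSystem F₀ i ^ ((⟨(-1) ^ ((s₁.val : ℤ) + (s₂.val : ℤ)), Subgroup.zpow_mem _ h1t _⟩,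
            fun i => ((b₁ i).val : ℤ) + ((b₂ i).val : ℤ)) : torsion F₀ × (Fin (rank F₀) → ℤ)).2 i := by
      change (-1) ^ (s₁.val : ℤ) * (∏ i, fundSystem F₀ i ^ ((b₁ i).val : ℤ)) *
          ((-1) ^ (s₂.val : ℤ) * ∏ i, fundSystem F₀ i ^ ((b₂ i).val : ℤ)) =
        (-1) ^ ((s₁.val : ℤ) + (s₂.val : ℤ)) * ∏ i, fundSystem F₀ i ^ (((b₁ i).val : ℤ) + ((b₂ i).val : ℤ))
      simp only [zpow_add, Finset.prod_mul_distrib]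
      simp only [mul_assoc, mul_left_comm]
    have hyn : U (s₁.val : ℤ) (fun i => ((b₁ i).val : ℤ)) * U (s₂.val : ℤ) (fun i => ((b₂ i).val : ℤ)) =
        (((⟨(ζ : (𝓞 F₀)ˣ) ^ 2, Subgroup.pow_mem _ ζ.2 2⟩, fun i => cy i + cy i) :
          torsion F₀ × (Fin (rank F₀) → ℤ)).1 : (𝓞 F₀)ˣ) *
          ∏ i, fundSystem F₀ i ^ ((⟨(ζ : (𝓞 F₀)ˣ) ^ 2, Subgroup.pow_mem _ ζ.2 2⟩, fun i => cy i + cy i) :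
            torsion F₀ × (Fin (rank F₀) → ℤ)).2 i := by
      rw [hy, hyd]
      change ((ζ : (𝓞 F₀)ˣ) * ∏ i, fundSystem F₀ i ^ cy i) ^ 2 = (ζ : (𝓞 F₀)ˣ) ^ 2 * ∏ i, fundSystem F₀ i ^ (cy i + cy i)
      simp only [sq, zpow_add, Finset.prod_mul_distrib]
      simp only [mul_assoc, mul_left_comm]
    have huniq := (exist_unique_eq_mul_prod F₀ _).unique hxn hyn
    simp only [Prod.mk.injEq, Subtype.mk.injEq] at huniq
    obtain ⟨hζ, hb⟩ := huniq
    -- `ζ_y = ±1`, so `(-1)^{p₀+q₀} = ζ_y² = 1`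
    have hζ2 : (ζ : (𝓞 F₀)ˣ) ^ 2 = 1 := by
      rcases coe_torsion_eq_one_or_eq_neg_one_tc hTR ζ with h | h
      · rw [h, one_pow]
      · rw [h, neg_one_sq]
    have hm1 : (-1 : (𝓞 F₀)ˣ) ≠ 1 := fun h => by
      have h' := congrArg (fun u : (𝓞 F₀)ˣ => ((u : 𝓞 F₀) : F₀)) h
      simp only [NumberField.Units.coe_neg_one, NumberField.Units.coe_one] at h'
      exact two_ne_zero (by linear_combination -h' : (2 : F₀) = 0)
    have hs₁ := s₁.val_lt
    have hs₂ := s₂.val_lt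
    have hs12 : s₁.val = s₂.val := by
      by_contra hs
      have hodd : (s₁.val : ℤ) + (s₂.val : ℤ) = 1 := by omega
      rw [hodd, zpow_one, hζ2] at hζ
      exact hm1 hζ
    have hb12 : ∀ i, (b₁ i).val = (b₂ i).val := fun i => by
      have hbi : ((b₁ i).val : ℤ) + ((b₂ i).val : ℤ) = cy i + cy i := congrFun hb i
      have h₁ := (b₁ i).val_lt
      have h₂ := (b₂ i).val_lt
      omega
    exact Prod.ext (ZMod.val_injective 2 hs12) (funext fun i => ZMod.val_injective 2 (hb12 i))
  -- both sides have `2^n` elements, `n = #places = r + 1`; so `Ψ` is onto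
  have hcard : Fintype.card (ZMod 2 × (Fin (rank F₀) → ZMod 2)) = Fintype.card (InfinitePlace F₀ → ZMod 2) := by
    rw [Fintype.card_prod, Fintype.card_fun, Fintype.card_fun, ZMod.card, Fintype.card_fin, ← pow_succ']
    congr 1
    change Fintype.card (InfinitePlace F₀) - 1 + 1 = _
    exact Nat.sub_add_cancel Fintype.card_pos
  have hsurj : Function.Surjective Ψ :=
    (Finite.injective_iff_surjective_of_equiv (Fintype.equivOfCardEq hcard)).mp hinj
  -- the prescribed signature, read on the places
  obtain ⟨⟨s, b⟩, hsb⟩ := hsurj fun w => if e w ∈ S then 1 else 0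
  refine ⟨U (s.val : ℤ) (fun i => ((b i).val : ℤ)), fun φ => ?_⟩
  obtain ⟨w, rfl⟩ := exists_embedding_of_isReal_eq_tc hTR φ
  have hw := congrFun hsb w
  change (if e w (((U (s.val : ℤ) (fun i => ((b i).val : ℤ)) : (𝓞 F₀)ˣ) : 𝓞 F₀) : F₀) < 0 then (1 : ZMod 2) else 0) =
    (if e w ∈ S then 1 else 0) at hw
  constructor
  · intro hlt
    rw [if_pos hlt] at hw
    by_contra hS
    rw [if_neg hS] at hw
    exact absurd hw (by decide)
  · intro hS
    rw [if_pos hS] at hw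
    by_contra hlt
    rw [if_neg hlt] at hw
    exact absurd hw (by decide)

include hTR in
/-- **FOR TOTALLY REAL `Ḟ` THE TWO HYPOTHESES ARE EQUIVALENT**: « units with any given signature » (Lemmermeyer's
hypothesis of Prop. 1 c)) ⟺ every totally positive unit is a square in `𝓞_Ḟ^×` (the hypothesis of (2)) — the
signature count read both ways.
[cite: Lemmermeyer1995, §2 Proposition 1 c) (hypothesis « $L^+$ contains units with any given signature ») and its proof (« our assumption implies that totally positive units are squares »), for totally real $L^+$: the equivalence; proved here (Dirichlet's unit theorem through Mathlib)] -/
theorem exists_units_neg_iff_iff_forall_units_eq_sq_of_pos :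
    (∀ S : Set (F₀ →+* ℝ), ∃ u : (𝓞 F₀)ˣ, ∀ φ : F₀ →+* ℝ, φ ((u : 𝓞 F₀) : F₀) < 0 ↔ φ ∈ S) ↔
      ∀ u : (𝓞 F₀)ˣ, (∀ φ : F₀ →+* ℝ, 0 < φ ((u : 𝓞 F₀) : F₀)) → ∃ t : (𝓞 F₀)ˣ, u = t ^ 2 :=
  ⟨fun h u hu => forall_units_eq_sq_of_pos_of_signatures hTR h u hu,
    fun h S => exists_units_neg_iff_of_forall_pos_eq_sq hTR h S⟩

end SignatureCount

end Literature.NumberTheory.Automorphic.Arthur2013.Leaves.TECR.TorusDict
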